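import Summits.ResolutionOfSingularities.ResolutionOfSingularities.Theorems.RadicialJungCleanModelsStubCossartPiltant2019OfLeavesClosed
import HarnessLib

/-!
# `CleanModels`, stub 2 (F-02) BY ITS TYPE from five NAMED printed statements — the two push-down statements of [CoP1] §9 named

OURS (decomp-res hand-1 g20; crux `stmt-ResolutionOfSingularities-15917`, skeleton rev 35 `Cruxes/CleanModels/Lines/Sketch.lean`,
stub `stub_cossartPiltant2019 : CossartPiltant2019.{0}`). Companion of `RadicialJungCleanModelsStubCossartPiltant2019OfPrintedDescent.lean`
(same generation), which re-keys the TYPE of stub 2 on the printed STATEMENTS [CoP1] Lemma 9.4 (totally ramified Kummer core) and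
[CoP1] Prop. 9.3 as anonymous hypotheses (`hKummer`, `hUnram`, verbatim the binders of the tree's
`cossartPiltant2019ReductionP_of_emb_of_kummer`).  Here the two printed statements are NAMED, in the tree's vocabulary for the
Cossart–Piltant climb (complete regular local base `S` of dimension three and residue characteristic `p`, algebraically closed
ambient valued field `(E, O_E)` dominating `S` with algebraic residue extension and rank one, local uniformization of a subfield
`X ∋ S` = a finitely generated model `S[t] ⊆ O_E`, `t ⊆ X ⊆ Frac S(t)`, regular at the centre), as NAMED UNPROVED CLAIMS
(`@[conjecture] def`: by D-0026 a published statement whose published proof this programme found incomplete is carried as a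
conjecture / conditional input, not as a Literature fact — the gate's `literature.conjecture` ruling on p833664), so that the planner
can carry them as named leaves (crux items or `--conditional-on`):

* `CossartPiltant2008_lemma94_kummerCore` — [CoP1] Lemma 9.4 in its hard case `s = f = pᵈ = 1, e = ℓ` ("pushing down local
  uniformization" through a totally ramified Kummer step `A(θ) | A` of prime degree `ℓ ≠ p`, `ζ_ℓ ∈ A`);
* `CossartPiltant2008_prop93` — [CoP1] Prop. 9.3 (pushing down local uniformization from `K′` to `M` for `M ≤ K′ ≤ Mⁱ`, `Mⁱ` the
  inertia field of a finite Galois `N | M`);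
* `cossartPiltant2019_of_stub1_of_lemma94_of_prop93_of_hironaka` — **`CossartPiltant2019.{0}` (the TYPE of stub 2) from
  `CossartPiltant2019Local.{0}` (CP 2019 Thm. 1.5), `CossartJannsenSaito2020Embedded.{0}` (CJS Thm. 1.4 = stub 1),
  `CossartPiltant2008_lemma94_kummerCore.{0}`, `CossartPiltant2008_prop93.{0}`, `Hironaka1964_local.{0}` (char. `0` only).**

PROOF-STATUS FLAGS (honest framing, hand-1 g10–g20).  Both named statements are CLAIMED AND PROVED IN PRINT ([CoP1], J. Algebra 320
(2008); re-used "characteristic free" by [CossartPiltant2019], proof of Prop. 4.10), but each printed proof contains one step this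
programme could not justify: Lemma 9.4's "`S` is stable by `G`, since any conjugate of `S` is dominated by `W`, hence equal to `S`"
(HAL hal-00139124 p. 29 l. 16) is false as a general sentence about regular local models dominated by a common valuation — two
`G`-conjugate small resolutions of a `G`-stable compound Du Val point are a counterexample (`Cruxes/CleanModels/Lines/Sketch-memo-hand1-g19.md`
(F5), `…-g20.md`) — and Prop. 9.3's reduction `K′ ≤ Kⁱ ⇝ K′ = Kˢ` takes invariants `(S₀ⁱ)^{Gˢ/Gⁱ}` of a normal model that need not be
`Gˢ`-stable.  What each printed proof needs is an EQUIVARIANT local uniformization (the tree's `hStabLoc` / `hStabIη`, research);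
the statements themselves stand in print and are recorded here as such.  Nothing in this file proves resolution of singularities
in positive characteristic, local uniformization in dimension three, or any statement of a manuscript under adjudication; rung 0.
AI-written; AI review weaker than expert review.
-/

-- `Summit.<Summit>.<Sub>.Theorems` with `Sub = Summit` (single-conjunct summit, D-0017)
set_option linter.dupNamespace false

noncomputable section

open IsLocalRing Polynomial AlgebraicGeometry
open _root_.IntermediateField
open Literature.AlgebraicGeometry.Resolution
open Summit.ResolutionOfSingularities.ResolutionOfSingularities.Theorems.CP2008Prop44

namespace Summit.ResolutionOfSingularities.ResolutionOfSingularities.Theorems.RadicialJung.CleanModels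

universe u

/-- **Cossart–Piltant 2008, Lemma 9.4 (pushing down local uniformization through a tamely ramified extension of prime degree),
in its hard case `s = f = pᵈ = 1`, `e = ℓ`, in the frame of Cossart–Piltant 2019, proof of Prop. 4.10.**  Printed statement
([CoP1] Lemma 9.4): for a Galois extension `L | K` of prime degree `ℓ ≠ p` of function fields of transcendence degree three and a
rank-one valuation ring `W` of `L` with algebraic residue field, a local uniformization of `W` gives one of `W ∩ K`; Cossart–Piltant
2019 (proof of Prop. 4.10, "(LU vʳ) ⟹ (LU vⁱ) … characteristic free") use it over a complete regular local base.  Tree form (the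
binder `hKummer` of `cossartPiltant2019ReductionP_of_emb_of_kummer`, `ArithmeticalThreefoldsLocalDescentEmbChain1.lean`): `S` complete
regular local, excellent, `dim S = 3`, residue characteristic `p`; `(E, O_E)` an algebraically closed valued field, algebraic over
`S`, `O_E` dominating `S` with algebraic residue extension and rank one; `A ∋ S, ζ_ℓ` a subfield, `θ ∉ A`, `θ ^ ℓ ∈ A`, `v(θ) ≤ 1`,
`[A(θ) : A] = ℓ`, `A(θ) | A` Galois with inertia group `⊤`; then a local uniformization of `A(θ)` (a finite `t ⊆ A(θ)` with
`A(θ) ⊆ Frac S(t)`, `S[t] ⊆ O_E`, `S[t]` regular at the centre of `O_E`) yields one of `A`.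
PROOF-STATUS FLAG: the printed proof's sentence "`S` is stable by `G`, since any conjugate of `S` is dominated by `W`, hence equal
to `S`" (HAL hal-00139124 p. 29) is unjustified (counterexample: decomp-res hand-1 g19 memo (F5)); the remainder of the printed proof
(invariants, the lattice (53)–(54), `Ŝ₁^G` regular) is typed in the tree (`TameCyclicToricDescent*.lean`, `kummerCore_of_stableLocalRing`).
-- TODO(general form): [CoP1] states the lemma for every Galois `L | K` of prime degree `ℓ ≠ p` over a ground field `k`; the cases
-- other than `s = f = pᵈ = 1, e = ℓ` are [CoP1] Prop. 9.3, and the base here is Cossart–Piltant 2019's complete regular local `S`.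
[cite: CossartPiltant2008, Lemma 9.4 and its proof, Prop. 9.5 (HAL hal-00139124 pp. 28–30)]
[cite: CossartPiltant2019, proof of Prop. 4.10 (arXiv:1412.0868v1 Prop. 4.8, p. 54)]
[published statement; printed proof incomplete — carried as an UNPROVED CLAIM (`@[conjecture]`), not as a Literature fact] -/
@[conjecture] def CossartPiltant2008_lemma94_kummerCore : Prop :=
    ∀ (p : ℕ), p.Prime →
    ∀ (S : Type u) [CommRing S] [IsDomain S] [IsRegularLocalRing S],
      IsExcellentRing S → ringKrullDim S = 3 → CharP (ResidueField S) p →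
      IsAdicComplete (maximalIdeal S) S →
    ∀ (E : Type u) [Field E] [Algebra S E], Function.Injective (algebraMap S E) →
      IsAlgClosed E → Algebra.IsAlgebraic S E →
    ∀ (OE : ValuationSubring E), (∀ s : S, algebraMap S E s ∈ OE) →
      (∀ s ∈ maximalIdeal S, OE.valuation (algebraMap S E s) < 1) →
      (∀ y : OE, ∃ q : S[X], (∃ i, q.coeff i ∉ maximalIdeal S) ∧
        OE.valuation (q.eval₂ (algebraMap S E) y) < 1) →
    Nonempty OE.valuation.RankOne →
    ∀ (ℓ : ℕ), ℓ.Prime → ℓ ≠ p → ∀ (ζ : E), IsPrimitiveRoot ζ ℓ →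
    ∀ (A : Subfield E), (∀ s : S, algebraMap S E s ∈ A) → ζ ∈ A →
    ∀ (θ : E), θ ∉ A → θ ^ ℓ ∈ A → OE.valuation θ ≤ 1 →
      Module.finrank A (adjoin A ({θ} : Set E)) = ℓ → IsGalois A (adjoin A ({θ} : Set E)) →
      inertiaGroupIn OE (adjoin A ({θ} : Set E)) = ⊤ →
      (∃ t : Finset E, (t : Set E) ⊆ (adjoin A ({θ} : Set E)).toSubfield ∧
        (adjoin A ({θ} : Set E)).toSubfield ≤
          Subfield.closure (Set.range (algebraMap S E) ∪ (t : Set E)) ∧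
        ∃ hTO : (Algebra.adjoin S (t : Set E)).toSubring ≤ OE.toSubring,
          IsRegularLocalRing (Localization.AtPrime
            (Ideal.comap (Subring.inclusion hTO) (maximalIdeal OE)))) →
      (∃ t : Finset E, (t : Set E) ⊆ A ∧
        A ≤ Subfield.closure (Set.range (algebraMap S E) ∪ (t : Set E)) ∧
        ∃ hTO : (Algebra.adjoin S (t : Set E)).toSubring ≤ OE.toSubring,
          IsRegularLocalRing (Localization.AtPrime
            (Ideal.comap (Subring.inclusion hTO) (maximalIdeal OE))))

/-- **Cossart–Piltant 2008, Prop. 9.3 (pushing down local uniformization below the inertia field), in the frame of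
Cossart–Piltant 2019, proof of Prop. 4.10.**  Printed statement ([CoP1] Prop. 9.3): for `L | K` finite Galois of function fields of
transcendence degree three, `W` a rank-one valuation ring of `L` with algebraic residue field, `V = W ∩ K`, and an intermediate
field `K ⊆ K′ ⊆ Kⁱ` (the inertia field of `W` over `V`), a local uniformization of `W ∩ K′` gives one of `V` (lying below a local
uniformization of `W ∩ K′`); Cossart–Piltant 2019 (proof of Prop. 4.10: "(LU vⁱ), then (LU v) hold is an easy adaptation of [CoP1]
proposition 9.3 … characteristic free") use it over a complete regular local base.  Tree form (the binder `hUnram` of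
`cossartPiltant2019ReductionP_of_emb_of_kummer`): frame as in `CossartPiltant2008_lemma94_kummerCore`; `M ∋ S` a subfield, `N | M`
finite Galois inside `E`, `K′` a subfield with `M ≤ K′ ≤ Mⁱ` (`Mⁱ` = fixed field of `inertiaGroupIn O_E N`); then a local
uniformization of `K′` yields one of `M`.
PROOF-STATUS FLAG: the printed proof reduces `K′ ≤ Kⁱ` to `K′ = Kˢ` through the invariant ring `(S₀ⁱ)^{Gˢ/Gⁱ}` of the normal model
`S₀ⁱ` of `Kⁱ` above the given `S₀′ ⊆ K′` (HAL p. 27), which presupposes `S₀ⁱ` to be `Gˢ`-stable; the case `K′ ≤ Kˢ` (density of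
`R₁` in `R₁′ ⊆ R₁ʰ`, the elements `Fᵢ`, `Hⱼ`, Zariski's Main Theorem, HAL pp. 27–28) is typed in the tree
(`ArithmeticalThreefoldsLocalDescentDecompositionHead.lean`, `…MonomializationHead.lean`), and the inert layer is reduced there to an
equivariant local uniformization of `Mⁱ | Mˢ` (`hStabIη`, `inertLayer_descent_of_stableInertiaField`).
-- TODO(general form): [CoP1] states the proposition over a ground field `k` with the extra conclusion `S₀′ < S′` and a local
-- uniformization of `V` lying below `S′`; the base here is Cossart–Piltant 2019's complete regular local `S`.
[cite: CossartPiltant2008, Prop. 9.3 and its proof (HAL hal-00139124 pp. 26–28)]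
[cite: CossartPiltant2019, proof of Prop. 4.10 (arXiv:1412.0868v1 Prop. 4.8, p. 54)]
[published statement; printed proof incomplete — carried as an UNPROVED CLAIM (`@[conjecture]`), not as a Literature fact] -/
@[conjecture] def CossartPiltant2008_prop93 : Prop :=
    ∀ (p : ℕ), p.Prime →
    ∀ (S : Type u) [CommRing S] [IsDomain S] [IsRegularLocalRing S],
      IsExcellentRing S → ringKrullDim S = 3 → CharP (ResidueField S) p →
      IsAdicComplete (maximalIdeal S) S →
    ∀ (E : Type u) [Field E] [Algebra S E], Function.Injective (algebraMap S E) →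
      IsAlgClosed E → Algebra.IsAlgebraic S E →
    ∀ (OE : ValuationSubring E), (∀ s : S, algebraMap S E s ∈ OE) →
      (∀ s ∈ maximalIdeal S, OE.valuation (algebraMap S E s) < 1) →
      (∀ y : OE, ∃ q : S[X], (∃ i, q.coeff i ∉ maximalIdeal S) ∧
        OE.valuation (q.eval₂ (algebraMap S E) y) < 1) →
    Nonempty OE.valuation.RankOne →
    ∀ (M : Subfield E), (∀ s : S, algebraMap S E s ∈ M) →
    ∀ (N : IntermediateField M E) [FiniteDimensional M N] [IsGalois M N] (K' : Subfield E),
      M ≤ K' → K' ≤ (lift (fixedField (inertiaGroupIn OE N))).toSubfield →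
      (∃ t : Finset E, (t : Set E) ⊆ K' ∧
        K' ≤ Subfield.closure (Set.range (algebraMap S E) ∪ (t : Set E)) ∧
        ∃ hTO : (Algebra.adjoin S (t : Set E)).toSubring ≤ OE.toSubring,
          IsRegularLocalRing (Localization.AtPrime
            (Ideal.comap (Subring.inclusion hTO) (maximalIdeal OE)))) →
      (∃ t : Finset E, (t : Set E) ⊆ M ∧
        M ≤ Subfield.closure (Set.range (algebraMap S E) ∪ (t : Set E)) ∧
        ∃ hTO : (Algebra.adjoin S (t : Set E)).toSubring ≤ OE.toSubring,
          IsRegularLocalRing (Localization.AtPrime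
            (Ideal.comap (Subring.inclusion hTO) (maximalIdeal OE))))

/-- **The TYPE of stub 2, `CossartPiltant2019.{0}`, from five NAMED PRINTED STATEMENTS: `CossartPiltant2019Local.{0}` (CP 2019
Thm. 1.5), `CossartJannsenSaito2020Embedded.{0}` (CJS Thm. 1.4 = the type of stub 1), `CossartPiltant2008_lemma94_kummerCore.{0}`
([CoP1] Lemma 9.4), `CossartPiltant2008_prop93.{0}` ([CoP1] Prop. 9.3), `Hironaka1964_local.{0}` (used only at characteristic `0`).**
Proof: for a field `k` of characteristic `p`, (LU) for complete three-dimensional local domains of residue characteristic `p` is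
`cossartPiltant2019ReductionP_of_emb_of_kummer` (principalization `CossartPiltant2019Principalization_holds` and CJS Cor. 1.5
`CossartJannsenSaito2020Embedded.cor15` discharged) when `p` is prime, or `Hironaka1964_local.cpLocalUniformization_of_isAdicComplete`
when `p = 0`; then `localUniformization3_of_stub1_of_luComplete3` (hand-1 g19) and the proved patching `CossartPiltant2019Patching_holds`.
[cite: CossartPiltant2019, Thm. 1.1, Thm. 1.5, Props. 4.4, 4.6, 4.8, 4.10] [cite: CossartPiltant2008, Prop. 9.3, Lemma 9.4, Prop. 9.5]
[cite: CossartJannsenSaito2020, Thm. 1.2, Thm. 1.4, Cor. 1.5] [cite: Temkin2008, Thm. 1.1] [cite: NovacoskiSpivakovsky2014, Thm. 1.1, Cor. 2.17, §3.1] -/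
theorem cossartPiltant2019_of_stub1_of_lemma94_of_prop93_of_hironaka
    (hloc : CossartPiltant2019Local.{0}) (hCJSE : CossartJannsenSaito2020Embedded.{0})
    (h94 : CossartPiltant2008_lemma94_kummerCore.{0}) (h93 : CossartPiltant2008_prop93.{0})
    (hH : Hironaka1964_local.{0}) : CossartPiltant2019.{0} := by
  intro k _ X f hsep hlft hqc hred hdim
  obtain ⟨p, hp⟩ := CharP.exists k
  have hLU3 : ∀ (A : Type) [CommRing A] [IsDomain A] [IsLocalRing A] [IsNoetherianRing A]
      [IsAdicComplete (maximalIdeal A) A],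
      ringKrullDim A = 3 → CharP (ResidueField A) p → CPLocalUniformization A := by
    intro A _ _ _ _ _ hdimA hchar
    rcases CharP.char_is_prime_or_zero k p with hprime | h0
    · exact cossartPiltant2019ReductionP_of_emb_of_kummer hloc CossartPiltant2019Principalization_holds hCJSE
        (CossartJannsenSaito2020Embedded.cor15 hCJSE) h94 h93 hloc p hprime A hdimA hchar
    · subst h0
      haveI : CharZero (ResidueField A) := CharP.charP_to_charZero (ResidueField A)
      exact hH.cpLocalUniformization_of_isAdicComplete A inferInstance
  exact CossartPiltant2019Patching_holds k (cossartJannsenSaito2020_of_embedded hCJSE k)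
    (localUniformization3_of_stub1_of_luComplete3 p hCJSE hLU3 k) X f hsep hlft hqc hred hdim

end Summit.ResolutionOfSingularities.ResolutionOfSingularities.Theorems.RadicialJung.CleanModels

end
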